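import Mathlib.Tactic.Ring
import Mathlib.Tactic.Linarith
import Mathlib.Tactic.Positivity
import Mathlib.Tactic.LinearCombination
import Mathlib.Data.Real.Basic
import Summits.HodgeConjecture.HodgeConjecture.Theorems.WeilClassTestFormatFiveThreeQ2
import Summits.HodgeConjecture.HodgeConjecture.Theorems.WeilClassTestFormatFiveThreeLineQuintic
import HarnessLib

/-!
# Conjecture N (hodge-weil ladder, GAPS G51b), format (5,3), real charges: SIGN PATTERNS OF `K₀(1), K₀(2), K₀(3)`

Prover 2, generation 17 (note `run/shared/lean/b2b/hodge-weil/b2b-hweil-pv2-g17/REAL-N53-G17.md`); a companion of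
`WeilClassTestFormatFiveThreeLineQuintic.lean`. On the pure locus the three points `(v_g, K₀(g))`, `K₀(g) = ∏_e(u_e − v_g)`, lie on
the line `ℓ` (`K0_eq_line_g`) whose slope is `Q₄/12` (`Q4_eq_slope`). Hence:
* `Q4_mul_eq_K0_sub` — `Q₄·(v_h − v_g) = 12·(K₀(h) − K₀(g))` for the pairs `(1,2)`, `(2,3)`, `(1,3)`;
* `Q4_pos_of_K0_lt₁₂` / `₂₃` — if `v_g < v_h` and `K₀(g) < 0 < K₀(h)` then `Q₄ > 0`; so (`Glam_nonneg_of_K0_lt₁₂` / `₂₃`, with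
  pv2-g15's `conjectureN_53_of_Q4_nonneg`) `Q₂ + λQ₄ ≥ 0` for every `λ ≥ 0` — this covers the sorted charge patterns `(n₁,n₂,n₃)` of
  parity `(1,0,0)` and `(1,1,0)`: (1,2,2), (1,2,4), (1,4,4), (3,4,4), (1,1,2), (1,1,4), (1,3,4), (3,3,4) (strict patterns, since
  `sign K₀(g) = (−1)^{n_g}`);
* `no_config_K0_pmp` / `no_config_K0_mpm` — the sign patterns `(+,−,+)` and `(−,+,−)` of `(K₀(1),K₀(2),K₀(3))` with `v₁ < v₂ < v₃` are
  impossible (three collinear points cannot alternate in sign): the strict patterns of parity `(0,1,0)`, `(1,0,1)` —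
  (0,1,2), (0,1,4), (0,3,4), (2,3,4), (1,2,3), (1,2,5), (1,4,5), (3,4,5) — carry no centred configuration with `P4 = 0` at all.
Pure algebra; nothing here is a case of HC, a rung or a door edge; no statement of Markman's papers is used. New cell result ⇒ Summits/.
-/

set_option linter.dupNamespace false

open Summit.HodgeConjecture.HodgeConjecture.WeilClassTestFormatFiveThreeQ2
open Summit.HodgeConjecture.HodgeConjecture.WeilClassTestFormatFiveThreeLineQuintic

namespace Summit.HodgeConjecture.HodgeConjecture.WeilClassTestFormatFiveThreeK0Signs

/-- On the pure locus `Q₄·(v₂ − v₁) = 12·(K₀(2) − K₀(1))` (the chord slope of `g ↦ K₀(g)` is `Q₄/12`). -/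
theorem Q4_mul_eq_K0_sub₁₂ (u₁ u₂ u₃ u₄ u₅ v₁ v₂ v₃ : ℝ)
    (hC : u₁ + u₂ + u₃ + u₄ + u₅ = v₁ + v₂ + v₃)
    (hP4 : (u₁ ^ 3 + u₂ ^ 3 + u₃ ^ 3 + u₄ ^ 3 + u₅ ^ 3) - (v₁ ^ 3 + v₂ ^ 3 + v₃ ^ 3) = 0) :
    (3 * ((u₁ ^ 4 + u₂ ^ 4 + u₃ ^ 4 + u₄ ^ 4 + u₅ ^ 4) - (v₁ ^ 4 + v₂ ^ 4 + v₃ ^ 4)) - (3 / 2) * ((u₁ ^ 2 + u₂ ^ 2 + u₃ ^ 2 + u₄ ^ 2 + u₅ ^ 2) - (v₁ ^ 2 + v₂ ^ 2 + v₃ ^ 2)) ^ 2) * (v₂ - v₁)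
      = 12 * (((u₁ - v₂) * (u₂ - v₂) * (u₃ - v₂) * (u₄ - v₂) * (u₅ - v₂)) - ((u₁ - v₁) * (u₂ - v₁) * (u₃ - v₁) * (u₄ - v₁) * (u₅ - v₁))) := by
  have hs := Q4_eq_slope u₁ u₂ u₃ u₄ u₅ v₁ v₂ v₃ hC
  have hg := K0_eq_line₁ u₁ u₂ u₃ u₄ u₅ v₁ v₂ v₃ hC hP4
  have hh := K0_eq_line₂ u₁ u₂ u₃ u₄ u₅ v₁ v₂ v₃ hC hP4
  rw [hg, hh, hs, hP4]
  ring

/-- On the pure locus `Q₄·(v₃ − v₂) = 12·(K₀(3) − K₀(2))` (the chord slope of `g ↦ K₀(g)` is `Q₄/12`). -/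
theorem Q4_mul_eq_K0_sub₂₃ (u₁ u₂ u₃ u₄ u₅ v₁ v₂ v₃ : ℝ)
    (hC : u₁ + u₂ + u₃ + u₄ + u₅ = v₁ + v₂ + v₃)
    (hP4 : (u₁ ^ 3 + u₂ ^ 3 + u₃ ^ 3 + u₄ ^ 3 + u₅ ^ 3) - (v₁ ^ 3 + v₂ ^ 3 + v₃ ^ 3) = 0) :
    (3 * ((u₁ ^ 4 + u₂ ^ 4 + u₃ ^ 4 + u₄ ^ 4 + u₅ ^ 4) - (v₁ ^ 4 + v₂ ^ 4 + v₃ ^ 4)) - (3 / 2) * ((u₁ ^ 2 + u₂ ^ 2 + u₃ ^ 2 + u₄ ^ 2 + u₅ ^ 2) - (v₁ ^ 2 + v₂ ^ 2 + v₃ ^ 2)) ^ 2) * (v₃ - v₂)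
      = 12 * (((u₁ - v₃) * (u₂ - v₃) * (u₃ - v₃) * (u₄ - v₃) * (u₅ - v₃)) - ((u₁ - v₂) * (u₂ - v₂) * (u₃ - v₂) * (u₄ - v₂) * (u₅ - v₂))) := by
  have hs := Q4_eq_slope u₁ u₂ u₃ u₄ u₅ v₁ v₂ v₃ hC
  have hg := K0_eq_line₂ u₁ u₂ u₃ u₄ u₅ v₁ v₂ v₃ hC hP4
  have hh := K0_eq_line₃ u₁ u₂ u₃ u₄ u₅ v₁ v₂ v₃ hC hP4
  rw [hg, hh, hs, hP4]
  ring

/-- On the pure locus `Q₄·(v₃ − v₁) = 12·(K₀(3) − K₀(1))` (the chord slope of `g ↦ K₀(g)` is `Q₄/12`). -/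
theorem Q4_mul_eq_K0_sub₁₃ (u₁ u₂ u₃ u₄ u₅ v₁ v₂ v₃ : ℝ)
    (hC : u₁ + u₂ + u₃ + u₄ + u₅ = v₁ + v₂ + v₃)
    (hP4 : (u₁ ^ 3 + u₂ ^ 3 + u₃ ^ 3 + u₄ ^ 3 + u₅ ^ 3) - (v₁ ^ 3 + v₂ ^ 3 + v₃ ^ 3) = 0) :
    (3 * ((u₁ ^ 4 + u₂ ^ 4 + u₃ ^ 4 + u₄ ^ 4 + u₅ ^ 4) - (v₁ ^ 4 + v₂ ^ 4 + v₃ ^ 4)) - (3 / 2) * ((u₁ ^ 2 + u₂ ^ 2 + u₃ ^ 2 + u₄ ^ 2 + u₅ ^ 2) - (v₁ ^ 2 + v₂ ^ 2 + v₃ ^ 2)) ^ 2) * (v₃ - v₁)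
      = 12 * (((u₁ - v₃) * (u₂ - v₃) * (u₃ - v₃) * (u₄ - v₃) * (u₅ - v₃)) - ((u₁ - v₁) * (u₂ - v₁) * (u₃ - v₁) * (u₄ - v₁) * (u₅ - v₁))) := by
  have hs := Q4_eq_slope u₁ u₂ u₃ u₄ u₅ v₁ v₂ v₃ hC
  have hg := K0_eq_line₁ u₁ u₂ u₃ u₄ u₅ v₁ v₂ v₃ hC hP4
  have hh := K0_eq_line₃ u₁ u₂ u₃ u₄ u₅ v₁ v₂ v₃ hC hP4
  rw [hg, hh, hs, hP4]
  ring

/-- If `v₁ < v₂` and `K₀(1) < 0 < K₀(2)` then `Q₄ > 0` (pure locus). -/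
theorem Q4_pos_of_K0_lt₁₂ (u₁ u₂ u₃ u₄ u₅ v₁ v₂ v₃ : ℝ)
    (hC : u₁ + u₂ + u₃ + u₄ + u₅ = v₁ + v₂ + v₃)
    (hP4 : (u₁ ^ 3 + u₂ ^ 3 + u₃ ^ 3 + u₄ ^ 3 + u₅ ^ 3) - (v₁ ^ 3 + v₂ ^ 3 + v₃ ^ 3) = 0)
    (hv : v₁ < v₂) (hKg : (u₁ - v₁) * (u₂ - v₁) * (u₃ - v₁) * (u₄ - v₁) * (u₅ - v₁) < 0) (hKh : 0 < (u₁ - v₂) * (u₂ - v₂) * (u₃ - v₂) * (u₄ - v₂) * (u₅ - v₂)) :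
    0 < 3 * ((u₁ ^ 4 + u₂ ^ 4 + u₃ ^ 4 + u₄ ^ 4 + u₅ ^ 4) - (v₁ ^ 4 + v₂ ^ 4 + v₃ ^ 4)) - (3 / 2) * ((u₁ ^ 2 + u₂ ^ 2 + u₃ ^ 2 + u₄ ^ 2 + u₅ ^ 2) - (v₁ ^ 2 + v₂ ^ 2 + v₃ ^ 2)) ^ 2 := by
  have e := Q4_mul_eq_K0_sub₁₂ u₁ u₂ u₃ u₄ u₅ v₁ v₂ v₃ hC hP4
  have hpos : 0 < (3 * ((u₁ ^ 4 + u₂ ^ 4 + u₃ ^ 4 + u₄ ^ 4 + u₅ ^ 4) - (v₁ ^ 4 + v₂ ^ 4 + v₃ ^ 4)) - (3 / 2) * ((u₁ ^ 2 + u₂ ^ 2 + u₃ ^ 2 + u₄ ^ 2 + u₅ ^ 2) - (v₁ ^ 2 + v₂ ^ 2 + v₃ ^ 2)) ^ 2) * (v₂ - v₁) := by rw [e]; linarith only [hKg, hKh]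
  exact pos_of_pos_mul (v₂ - v₁) (3 * ((u₁ ^ 4 + u₂ ^ 4 + u₃ ^ 4 + u₄ ^ 4 + u₅ ^ 4) - (v₁ ^ 4 + v₂ ^ 4 + v₃ ^ 4)) - (3 / 2) * ((u₁ ^ 2 + u₂ ^ 2 + u₃ ^ 2 + u₄ ^ 2 + u₅ ^ 2) - (v₁ ^ 2 + v₂ ^ 2 + v₃ ^ 2)) ^ 2) (by linarith only [hv]) (by rw [mul_comm]; exact hpos)

/-- REAL CONJECTURE N (every `λ ≥ 0`) WHEN `K₀(1) < 0 < K₀(2)`, `v₁ < v₂`: then `Q₄ > 0` and pv2-g15's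
`conjectureN_53_of_Q4_nonneg` applies. (Strict charge patterns of parity (1,0,0) / (1,1,0).) -/
theorem Glam_nonneg_of_K0_lt₁₂ (A₁ A₂ A₃ A₄ A₅ B₁ B₂ B₃ u₁ u₂ u₃ u₄ u₅ v₁ v₂ v₃ : ℝ)
    (hA : A₁ + A₂ + A₃ + A₄ + A₅ = B₁ + B₂ + B₃) (hC : u₁ + u₂ + u₃ + u₄ + u₅ = v₁ + v₂ + v₃)
    (hP1 : (A₁ ^ 2 * u₁ + A₂ ^ 2 * u₂ + A₃ ^ 2 * u₃ + A₄ ^ 2 * u₄ + A₅ ^ 2 * u₅) - (B₁ ^ 2 * v₁ + B₂ ^ 2 * v₂ + B₃ ^ 2 * v₃) = 0)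
    (hP2 : (A₁ * u₁ ^ 2 + A₂ * u₂ ^ 2 + A₃ * u₃ ^ 2 + A₄ * u₄ ^ 2 + A₅ * u₅ ^ 2) - (B₁ * v₁ ^ 2 + B₂ * v₂ ^ 2 + B₃ * v₃ ^ 2) = 0)
    (hP4 : (u₁ ^ 3 + u₂ ^ 3 + u₃ ^ 3 + u₄ ^ 3 + u₅ ^ 3) - (v₁ ^ 3 + v₂ ^ 3 + v₃ ^ 3) = 0)
    (m₁₁ : |u₁ - v₁| ≤ A₁ - B₁) (m₂₁ : |u₂ - v₁| ≤ A₂ - B₁) (m₃₁ : |u₃ - v₁| ≤ A₃ - B₁) (m₄₁ : |u₄ - v₁| ≤ A₄ - B₁) (m₅₁ : |u₅ - v₁| ≤ A₅ - B₁)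
    (m₁₂ : |u₁ - v₂| ≤ A₁ - B₂) (m₂₂ : |u₂ - v₂| ≤ A₂ - B₂) (m₃₂ : |u₃ - v₂| ≤ A₃ - B₂) (m₄₂ : |u₄ - v₂| ≤ A₄ - B₂) (m₅₂ : |u₅ - v₂| ≤ A₅ - B₂)
    (m₁₃ : |u₁ - v₃| ≤ A₁ - B₃) (m₂₃ : |u₂ - v₃| ≤ A₂ - B₃) (m₃₃ : |u₃ - v₃| ≤ A₃ - B₃) (m₄₃ : |u₄ - v₃| ≤ A₄ - B₃) (m₅₃ : |u₅ - v₃| ≤ A₅ - B₃)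
    (hv : v₁ < v₂) (hKg : (u₁ - v₁) * (u₂ - v₁) * (u₃ - v₁) * (u₄ - v₁) * (u₅ - v₁) < 0) (hKh : 0 < (u₁ - v₂) * (u₂ - v₂) * (u₃ - v₂) * (u₄ - v₂) * (u₅ - v₂))
    (l : ℝ) (hl : 0 ≤ l) :
    0 ≤ (1 / 2) * ((A₁ ^ 2 + A₂ ^ 2 + A₃ ^ 2 + A₄ ^ 2 + A₅ ^ 2) - (B₁ ^ 2 + B₂ ^ 2 + B₃ ^ 2)) * ((u₁ ^ 2 + u₂ ^ 2 + u₃ ^ 2 + u₄ ^ 2 + u₅ ^ 2) - (v₁ ^ 2 + v₂ ^ 2 + v₃ ^ 2))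
        + ((A₁ * u₁ + A₂ * u₂ + A₃ * u₃ + A₄ * u₄ + A₅ * u₅) - (B₁ * v₁ + B₂ * v₂ + B₃ * v₃)) ^ 2
        - 3 * ((A₁ ^ 2 * u₁ ^ 2 + A₂ ^ 2 * u₂ ^ 2 + A₃ ^ 2 * u₃ ^ 2 + A₄ ^ 2 * u₄ ^ 2 + A₅ ^ 2 * u₅ ^ 2) - (B₁ ^ 2 * v₁ ^ 2 + B₂ ^ 2 * v₂ ^ 2 + B₃ ^ 2 * v₃ ^ 2))
      + l * (3 * ((u₁ ^ 4 + u₂ ^ 4 + u₃ ^ 4 + u₄ ^ 4 + u₅ ^ 4) - (v₁ ^ 4 + v₂ ^ 4 + v₃ ^ 4)) - (3 / 2) * ((u₁ ^ 2 + u₂ ^ 2 + u₃ ^ 2 + u₄ ^ 2 + u₅ ^ 2) - (v₁ ^ 2 + v₂ ^ 2 + v₃ ^ 2)) ^ 2) :=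
  conjectureN_53_of_Q4_nonneg A₁ A₂ A₃ A₄ A₅ B₁ B₂ B₃ u₁ u₂ u₃ u₄ u₅ v₁ v₂ v₃ hA hC hP1 hP2 m₁₁ m₂₁ m₃₁ m₄₁ m₅₁ m₁₂ m₂₂ m₃₂ m₄₂ m₅₂ m₁₃ m₂₃ m₃₃ m₄₃ m₅₃
    (le_of_lt (Q4_pos_of_K0_lt₁₂ u₁ u₂ u₃ u₄ u₅ v₁ v₂ v₃ hC hP4 hv hKg hKh)) l hl

/-- If `v₂ < v₃` and `K₀(2) < 0 < K₀(3)` then `Q₄ > 0` (pure locus). -/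
theorem Q4_pos_of_K0_lt₂₃ (u₁ u₂ u₃ u₄ u₅ v₁ v₂ v₃ : ℝ)
    (hC : u₁ + u₂ + u₃ + u₄ + u₅ = v₁ + v₂ + v₃)
    (hP4 : (u₁ ^ 3 + u₂ ^ 3 + u₃ ^ 3 + u₄ ^ 3 + u₅ ^ 3) - (v₁ ^ 3 + v₂ ^ 3 + v₃ ^ 3) = 0)
    (hv : v₂ < v₃) (hKg : (u₁ - v₂) * (u₂ - v₂) * (u₃ - v₂) * (u₄ - v₂) * (u₅ - v₂) < 0) (hKh : 0 < (u₁ - v₃) * (u₂ - v₃) * (u₃ - v₃) * (u₄ - v₃) * (u₅ - v₃)) :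
    0 < 3 * ((u₁ ^ 4 + u₂ ^ 4 + u₃ ^ 4 + u₄ ^ 4 + u₅ ^ 4) - (v₁ ^ 4 + v₂ ^ 4 + v₃ ^ 4)) - (3 / 2) * ((u₁ ^ 2 + u₂ ^ 2 + u₃ ^ 2 + u₄ ^ 2 + u₅ ^ 2) - (v₁ ^ 2 + v₂ ^ 2 + v₃ ^ 2)) ^ 2 := by
  have e := Q4_mul_eq_K0_sub₂₃ u₁ u₂ u₃ u₄ u₅ v₁ v₂ v₃ hC hP4
  have hpos : 0 < (3 * ((u₁ ^ 4 + u₂ ^ 4 + u₃ ^ 4 + u₄ ^ 4 + u₅ ^ 4) - (v₁ ^ 4 + v₂ ^ 4 + v₃ ^ 4)) - (3 / 2) * ((u₁ ^ 2 + u₂ ^ 2 + u₃ ^ 2 + u₄ ^ 2 + u₅ ^ 2) - (v₁ ^ 2 + v₂ ^ 2 + v₃ ^ 2)) ^ 2) * (v₃ - v₂) := by rw [e]; linarith only [hKg, hKh]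
  exact pos_of_pos_mul (v₃ - v₂) (3 * ((u₁ ^ 4 + u₂ ^ 4 + u₃ ^ 4 + u₄ ^ 4 + u₅ ^ 4) - (v₁ ^ 4 + v₂ ^ 4 + v₃ ^ 4)) - (3 / 2) * ((u₁ ^ 2 + u₂ ^ 2 + u₃ ^ 2 + u₄ ^ 2 + u₅ ^ 2) - (v₁ ^ 2 + v₂ ^ 2 + v₃ ^ 2)) ^ 2) (by linarith only [hv]) (by rw [mul_comm]; exact hpos)

/-- REAL CONJECTURE N (every `λ ≥ 0`) WHEN `K₀(2) < 0 < K₀(3)`, `v₂ < v₃`: then `Q₄ > 0` and pv2-g15's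
`conjectureN_53_of_Q4_nonneg` applies. (Strict charge patterns of parity (1,0,0) / (1,1,0).) -/
theorem Glam_nonneg_of_K0_lt₂₃ (A₁ A₂ A₃ A₄ A₅ B₁ B₂ B₃ u₁ u₂ u₃ u₄ u₅ v₁ v₂ v₃ : ℝ)
    (hA : A₁ + A₂ + A₃ + A₄ + A₅ = B₁ + B₂ + B₃) (hC : u₁ + u₂ + u₃ + u₄ + u₅ = v₁ + v₂ + v₃)
    (hP1 : (A₁ ^ 2 * u₁ + A₂ ^ 2 * u₂ + A₃ ^ 2 * u₃ + A₄ ^ 2 * u₄ + A₅ ^ 2 * u₅) - (B₁ ^ 2 * v₁ + B₂ ^ 2 * v₂ + B₃ ^ 2 * v₃) = 0)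
    (hP2 : (A₁ * u₁ ^ 2 + A₂ * u₂ ^ 2 + A₃ * u₃ ^ 2 + A₄ * u₄ ^ 2 + A₅ * u₅ ^ 2) - (B₁ * v₁ ^ 2 + B₂ * v₂ ^ 2 + B₃ * v₃ ^ 2) = 0)
    (hP4 : (u₁ ^ 3 + u₂ ^ 3 + u₃ ^ 3 + u₄ ^ 3 + u₅ ^ 3) - (v₁ ^ 3 + v₂ ^ 3 + v₃ ^ 3) = 0)
    (m₁₁ : |u₁ - v₁| ≤ A₁ - B₁) (m₂₁ : |u₂ - v₁| ≤ A₂ - B₁) (m₃₁ : |u₃ - v₁| ≤ A₃ - B₁) (m₄₁ : |u₄ - v₁| ≤ A₄ - B₁) (m₅₁ : |u₅ - v₁| ≤ A₅ - B₁)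
    (m₁₂ : |u₁ - v₂| ≤ A₁ - B₂) (m₂₂ : |u₂ - v₂| ≤ A₂ - B₂) (m₃₂ : |u₃ - v₂| ≤ A₃ - B₂) (m₄₂ : |u₄ - v₂| ≤ A₄ - B₂) (m₅₂ : |u₅ - v₂| ≤ A₅ - B₂)
    (m₁₃ : |u₁ - v₃| ≤ A₁ - B₃) (m₂₃ : |u₂ - v₃| ≤ A₂ - B₃) (m₃₃ : |u₃ - v₃| ≤ A₃ - B₃) (m₄₃ : |u₄ - v₃| ≤ A₄ - B₃) (m₅₃ : |u₅ - v₃| ≤ A₅ - B₃)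
    (hv : v₂ < v₃) (hKg : (u₁ - v₂) * (u₂ - v₂) * (u₃ - v₂) * (u₄ - v₂) * (u₅ - v₂) < 0) (hKh : 0 < (u₁ - v₃) * (u₂ - v₃) * (u₃ - v₃) * (u₄ - v₃) * (u₅ - v₃))
    (l : ℝ) (hl : 0 ≤ l) :
    0 ≤ (1 / 2) * ((A₁ ^ 2 + A₂ ^ 2 + A₃ ^ 2 + A₄ ^ 2 + A₅ ^ 2) - (B₁ ^ 2 + B₂ ^ 2 + B₃ ^ 2)) * ((u₁ ^ 2 + u₂ ^ 2 + u₃ ^ 2 + u₄ ^ 2 + u₅ ^ 2) - (v₁ ^ 2 + v₂ ^ 2 + v₃ ^ 2))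
        + ((A₁ * u₁ + A₂ * u₂ + A₃ * u₃ + A₄ * u₄ + A₅ * u₅) - (B₁ * v₁ + B₂ * v₂ + B₃ * v₃)) ^ 2
        - 3 * ((A₁ ^ 2 * u₁ ^ 2 + A₂ ^ 2 * u₂ ^ 2 + A₃ ^ 2 * u₃ ^ 2 + A₄ ^ 2 * u₄ ^ 2 + A₅ ^ 2 * u₅ ^ 2) - (B₁ ^ 2 * v₁ ^ 2 + B₂ ^ 2 * v₂ ^ 2 + B₃ ^ 2 * v₃ ^ 2))
      + l * (3 * ((u₁ ^ 4 + u₂ ^ 4 + u₃ ^ 4 + u₄ ^ 4 + u₅ ^ 4) - (v₁ ^ 4 + v₂ ^ 4 + v₃ ^ 4)) - (3 / 2) * ((u₁ ^ 2 + u₂ ^ 2 + u₃ ^ 2 + u₄ ^ 2 + u₅ ^ 2) - (v₁ ^ 2 + v₂ ^ 2 + v₃ ^ 2)) ^ 2) :=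
  conjectureN_53_of_Q4_nonneg A₁ A₂ A₃ A₄ A₅ B₁ B₂ B₃ u₁ u₂ u₃ u₄ u₅ v₁ v₂ v₃ hA hC hP1 hP2 m₁₁ m₂₁ m₃₁ m₄₁ m₅₁ m₁₂ m₂₂ m₃₂ m₄₂ m₅₂ m₁₃ m₂₃ m₃₃ m₄₃ m₅₃
    (le_of_lt (Q4_pos_of_K0_lt₂₃ u₁ u₂ u₃ u₄ u₅ v₁ v₂ v₃ hC hP4 hv hKg hKh)) l hl

/-- THREE COLLINEAR POINTS CANNOT ALTERNATE IN SIGN: with `v₁ < v₂ < v₃`, `K₀(1) > 0 > K₀(2)`, `K₀(3) > 0` is impossible on the pure locus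
(centring + P4). (Strict charge patterns of parity (0,1,0).) -/
theorem no_config_K0_pmp (u₁ u₂ u₃ u₄ u₅ v₁ v₂ v₃ : ℝ)
    (hC : u₁ + u₂ + u₃ + u₄ + u₅ = v₁ + v₂ + v₃)
    (hP4 : (u₁ ^ 3 + u₂ ^ 3 + u₃ ^ 3 + u₄ ^ 3 + u₅ ^ 3) - (v₁ ^ 3 + v₂ ^ 3 + v₃ ^ 3) = 0)
    (h12 : v₁ < v₂) (h23 : v₂ < v₃) (hK1 : 0 < (u₁ - v₁) * (u₂ - v₁) * (u₃ - v₁) * (u₄ - v₁) * (u₅ - v₁)) (hK2 : (u₁ - v₂) * (u₂ - v₂) * (u₃ - v₂) * (u₄ - v₂) * (u₅ - v₂) < 0) (hK3 : 0 < (u₁ - v₃) * (u₂ - v₃) * (u₃ - v₃) * (u₄ - v₃) * (u₅ - v₃)) : False := by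
  have hl1 := K0_eq_line₁ u₁ u₂ u₃ u₄ u₅ v₁ v₂ v₃ hC hP4
  have hl2 := K0_eq_line₂ u₁ u₂ u₃ u₄ u₅ v₁ v₂ v₃ hC hP4
  have hl3 := K0_eq_line₃ u₁ u₂ u₃ u₄ u₅ v₁ v₂ v₃ hC hP4
  have e : (v₃ - v₁) * (((u₁ * u₂ * u₃ * u₄ * u₅) + (v₁ * v₂ * v₃) * ((u₁ ^ 2 + u₂ ^ 2 + u₃ ^ 2 + u₄ ^ 2 + u₅ ^ 2) - (v₁ ^ 2 + v₂ ^ 2 + v₃ ^ 2)) / 2) + (-((u₁ * u₂ * u₃ * u₄ + u₁ * u₂ * u₃ * u₅ + u₁ * u₂ * u₄ * u₅ + u₁ * u₃ * u₄ * u₅ + u₂ * u₃ * u₄ * u₅) + (v₁ * v₂ + v₁ * v₃ + v₂ * v₃) * ((u₁ ^ 2 + u₂ ^ 2 + u₃ ^ 2 + u₄ ^ 2 + u₅ ^ 2) - (v₁ ^ 2 + v₂ ^ 2 + v₃ ^ 2)) / 2)) * v₂)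
      = (v₃ - v₂) * (((u₁ * u₂ * u₃ * u₄ * u₅) + (v₁ * v₂ * v₃) * ((u₁ ^ 2 + u₂ ^ 2 + u₃ ^ 2 + u₄ ^ 2 + u₅ ^ 2) - (v₁ ^ 2 + v₂ ^ 2 + v₃ ^ 2)) / 2) + (-((u₁ * u₂ * u₃ * u₄ + u₁ * u₂ * u₃ * u₅ + u₁ * u₂ * u₄ * u₅ + u₁ * u₃ * u₄ * u₅ + u₂ * u₃ * u₄ * u₅) + (v₁ * v₂ + v₁ * v₃ + v₂ * v₃) * ((u₁ ^ 2 + u₂ ^ 2 + u₃ ^ 2 + u₄ ^ 2 + u₅ ^ 2) - (v₁ ^ 2 + v₂ ^ 2 + v₃ ^ 2)) / 2)) * v₁)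
        + (v₂ - v₁) * (((u₁ * u₂ * u₃ * u₄ * u₅) + (v₁ * v₂ * v₃) * ((u₁ ^ 2 + u₂ ^ 2 + u₃ ^ 2 + u₄ ^ 2 + u₅ ^ 2) - (v₁ ^ 2 + v₂ ^ 2 + v₃ ^ 2)) / 2) + (-((u₁ * u₂ * u₃ * u₄ + u₁ * u₂ * u₃ * u₅ + u₁ * u₂ * u₄ * u₅ + u₁ * u₃ * u₄ * u₅ + u₂ * u₃ * u₄ * u₅) + (v₁ * v₂ + v₁ * v₃ + v₂ * v₃) * ((u₁ ^ 2 + u₂ ^ 2 + u₃ ^ 2 + u₄ ^ 2 + u₅ ^ 2) - (v₁ ^ 2 + v₂ ^ 2 + v₃ ^ 2)) / 2)) * v₃) := by ring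
  rw [← hl1, ← hl2, ← hl3] at e
  have a : 0 < v₃ - v₂ := by linarith only [h23]
  have b : 0 < v₂ - v₁ := by linarith only [h12]
  have c : 0 < v₃ - v₁ := by linarith only [h12, h23]

  have t1 : 0 < (v₃ - v₂) * ((u₁ - v₁) * (u₂ - v₁) * (u₃ - v₁) * (u₄ - v₁) * (u₅ - v₁)) := mul_pos a hK1
  have t3 : 0 < (v₂ - v₁) * ((u₁ - v₃) * (u₂ - v₃) * (u₃ - v₃) * (u₄ - v₃) * (u₅ - v₃)) := mul_pos b hK3
  have t2 : (v₃ - v₁) * ((u₁ - v₂) * (u₂ - v₂) * (u₃ - v₂) * (u₄ - v₂) * (u₅ - v₂)) < 0 := mul_neg_of_pos_of_neg c hK2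
  linarith only [e, t1, t2, t3]

/-- THREE COLLINEAR POINTS CANNOT ALTERNATE IN SIGN: with `v₁ < v₂ < v₃`, `K₀(1) < 0 < K₀(2)`, `K₀(3) < 0` is impossible on the pure locus
(centring + P4). (Strict charge patterns of parity (1,0,1).) -/
theorem no_config_K0_mpm (u₁ u₂ u₃ u₄ u₅ v₁ v₂ v₃ : ℝ)
    (hC : u₁ + u₂ + u₃ + u₄ + u₅ = v₁ + v₂ + v₃)
    (hP4 : (u₁ ^ 3 + u₂ ^ 3 + u₃ ^ 3 + u₄ ^ 3 + u₅ ^ 3) - (v₁ ^ 3 + v₂ ^ 3 + v₃ ^ 3) = 0)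
    (h12 : v₁ < v₂) (h23 : v₂ < v₃) (hK1 : (u₁ - v₁) * (u₂ - v₁) * (u₃ - v₁) * (u₄ - v₁) * (u₅ - v₁) < 0) (hK2 : 0 < (u₁ - v₂) * (u₂ - v₂) * (u₃ - v₂) * (u₄ - v₂) * (u₅ - v₂)) (hK3 : (u₁ - v₃) * (u₂ - v₃) * (u₃ - v₃) * (u₄ - v₃) * (u₅ - v₃) < 0) : False := by
  have hl1 := K0_eq_line₁ u₁ u₂ u₃ u₄ u₅ v₁ v₂ v₃ hC hP4
  have hl2 := K0_eq_line₂ u₁ u₂ u₃ u₄ u₅ v₁ v₂ v₃ hC hP4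
  have hl3 := K0_eq_line₃ u₁ u₂ u₃ u₄ u₅ v₁ v₂ v₃ hC hP4
  have e : (v₃ - v₁) * (((u₁ * u₂ * u₃ * u₄ * u₅) + (v₁ * v₂ * v₃) * ((u₁ ^ 2 + u₂ ^ 2 + u₃ ^ 2 + u₄ ^ 2 + u₅ ^ 2) - (v₁ ^ 2 + v₂ ^ 2 + v₃ ^ 2)) / 2) + (-((u₁ * u₂ * u₃ * u₄ + u₁ * u₂ * u₃ * u₅ + u₁ * u₂ * u₄ * u₅ + u₁ * u₃ * u₄ * u₅ + u₂ * u₃ * u₄ * u₅) + (v₁ * v₂ + v₁ * v₃ + v₂ * v₃) * ((u₁ ^ 2 + u₂ ^ 2 + u₃ ^ 2 + u₄ ^ 2 + u₅ ^ 2) - (v₁ ^ 2 + v₂ ^ 2 + v₃ ^ 2)) / 2)) * v₂)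
      = (v₃ - v₂) * (((u₁ * u₂ * u₃ * u₄ * u₅) + (v₁ * v₂ * v₃) * ((u₁ ^ 2 + u₂ ^ 2 + u₃ ^ 2 + u₄ ^ 2 + u₅ ^ 2) - (v₁ ^ 2 + v₂ ^ 2 + v₃ ^ 2)) / 2) + (-((u₁ * u₂ * u₃ * u₄ + u₁ * u₂ * u₃ * u₅ + u₁ * u₂ * u₄ * u₅ + u₁ * u₃ * u₄ * u₅ + u₂ * u₃ * u₄ * u₅) + (v₁ * v₂ + v₁ * v₃ + v₂ * v₃) * ((u₁ ^ 2 + u₂ ^ 2 + u₃ ^ 2 + u₄ ^ 2 + u₅ ^ 2) - (v₁ ^ 2 + v₂ ^ 2 + v₃ ^ 2)) / 2)) * v₁)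
        + (v₂ - v₁) * (((u₁ * u₂ * u₃ * u₄ * u₅) + (v₁ * v₂ * v₃) * ((u₁ ^ 2 + u₂ ^ 2 + u₃ ^ 2 + u₄ ^ 2 + u₅ ^ 2) - (v₁ ^ 2 + v₂ ^ 2 + v₃ ^ 2)) / 2) + (-((u₁ * u₂ * u₃ * u₄ + u₁ * u₂ * u₃ * u₅ + u₁ * u₂ * u₄ * u₅ + u₁ * u₃ * u₄ * u₅ + u₂ * u₃ * u₄ * u₅) + (v₁ * v₂ + v₁ * v₃ + v₂ * v₃) * ((u₁ ^ 2 + u₂ ^ 2 + u₃ ^ 2 + u₄ ^ 2 + u₅ ^ 2) - (v₁ ^ 2 + v₂ ^ 2 + v₃ ^ 2)) / 2)) * v₃) := by ring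
  rw [← hl1, ← hl2, ← hl3] at e
  have a : 0 < v₃ - v₂ := by linarith only [h23]
  have b : 0 < v₂ - v₁ := by linarith only [h12]
  have c : 0 < v₃ - v₁ := by linarith only [h12, h23]

  have t1 : (v₃ - v₂) * ((u₁ - v₁) * (u₂ - v₁) * (u₃ - v₁) * (u₄ - v₁) * (u₅ - v₁)) < 0 := mul_neg_of_pos_of_neg a hK1
  have t3 : (v₂ - v₁) * ((u₁ - v₃) * (u₂ - v₃) * (u₃ - v₃) * (u₄ - v₃) * (u₅ - v₃)) < 0 := mul_neg_of_pos_of_neg b hK3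
  have t2 : 0 < (v₃ - v₁) * ((u₁ - v₂) * (u₂ - v₂) * (u₃ - v₂) * (u₄ - v₂) * (u₅ - v₂)) := mul_pos c hK2
  linarith only [e, t1, t2, t3]

end Summit.HodgeConjecture.HodgeConjecture.WeilClassTestFormatFiveThreeK0Signs
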